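import Literature.MathematicalPhysics.QuantumFieldTheory.Balaban1983to89.Node00.RateRecordW1Maps

/-!
# NODE 00 — THE HISTORY RECURSION OF RECORD: run lengths, and W1's (2.13)–(2.14) terms GENERATED step by step from
the last coupling and the older terms

Fourth module of the definer seat `pub-ymgap-node00-def-W1` (g4; §4 added by g5 as v1.2), after `Node00.HistoryTermsOfRecord` (g0: the OBJECT — W1's one-step cluster data
`W1.ClusterStep`, the towers `W1.ClusterTower`, the terms `W1.termC S j X g φ = E^{(j)}(X; g₀,…,g_{j−1}; φ)`, (2.13) DEFINITIONAL as `B13Resummation.locE`),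
`Node00.RateRecordW1Reading` (g2: `W1.LevelPairing` ∕ `W1.ReadingData` ∕ the termless tower) and `Node00.RateRecordW1Maps` (g3: the pairing and the
reading OF RECORD, the small-field-tower dictionary).  Those modules type the terms of ONE step as DATA reading the whole young-coupling prefix
`(g₀, …, g_k)`; two things the record determines were left free, and both were asked for on the pub-ymgap bus by the live N22 seats:

* (§1) **RUN LENGTH.**  [I] (0.23)–(0.24): the run of `k` renormalization steps on the `k`-th torus creates terms at the creation steps `j = 1, …, k`
  and NO OTHERS («E_k = Σ_{j=1}^{k} E^{(j)}»).  g2∕g3's `ReadingData.ofRecord F M N S …` takes one full tower `S k : W1.ClusterTower (F.P k) 𝔸 M` per run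
  length, so «no term after step `k`» is a property of the data, not a face (dag-n22-c g3 (J) «steps ≥ k of the run-length-k tower termless», dag-n22-e g3
  (K0) «k < j ⇒ Re E^{(j)}_{S k}(X; ·; ·) = 0», both carried as displayed hypotheses `hjunk`).  Here: the RUN-LENGTH TRUNCATION `truncRun K S` (steps
  `< K` kept, steps `≥ K` termless), the predicate `TermlessBeyond S K`, the towers of the runs of record `runTowers S k := truncRun k (S k)`, and the
  (J)∕(K0) literal PROVED for every reading datum whose towers are termless beyond the run length (`ReadingData.EA_eq_zero_of_termlessBeyond`) — in
  particular at `ReadingData.ofRecord F M N (runTowers S) …` (`ReadingData.EA_ofRecord_runTowers_eq_zero`); truncation preserves every clause of record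
  stated of a tower (`termBound118_truncRun`, `termAnalytic_truncRun`, `termDerivBound_truncRun`, `smoothInLastOfRecord_truncRun`, `analyticInEachOfRecord_truncRun`,
  `analyticInLastOfRecord_truncRun`; eliminator `truncRun_cases`; and node N09's holomorphic currency: `eHoloAtTruncRun` ∕ `eHoloAtTruncRunZero` ∕
  `exists_eHoloAt_truncRun_of_lt` ∕ `exists_eHoloAt_truncRun` — a family of `EHoloAt`'s with uniform `(E₀, r)` on g3's `sfTowerOfRecord … S …` below the
  run length gives one on `… (truncRun K S) …` at every level), so
  `runTowers S` is a drop-in for `S` in the consumers' hypotheses.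
* (§2–§3) **THE RECURSION.**  NODE-TABLE row N22: «wall = the one-step RG model W1 = [II] §2 (2.13)–(2.14) as a Lean OBJECT; FLAG: the history-dependence
  object is not in print».  In print the term created at step `k + 1` is a function of the LAST coupling `g_k` and of the OLDER TERMS `E^{(1)}, …, E^{(k)}`
  — and of the earlier couplings `g₀, …, g_{k−1}` ONLY THROUGH those:
  [I] (2.12)–(2.13) p.268 «The expression under the exponential is clearly a sum of two terms, one is connected with the expansion of the action
  −(1∕g_k²)A(U_k(V)) and the measure in (2.1), and we denote it by P^{(k)}(g_k, U_{k+1}, B), another is the expression in the curly bracket {…}. The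
  integral in (2.12) defines the new term E^{(k+1)} in the inductive definition of the action A_{k+1} by the formula
  E^{(k+1)}(g_k, U_{k+1}) = log ∫ dμ_{C^{(k)}}(B) χ_k exp[P^{(k)}(g_k, U_{k+1}, B) + {…}]» (the curly bracket = the difference of two evaluations of the
  old action `E_k = Σ_{j≤k} Σ_X E^{(j)}(X)`, [I] (0.22)–(0.23) p.256 «The function E_k depends also on the effective coupling constants g₀, …, g_{k−1}»);
  [II] Lemma 2 (1.41) p.11 «The fluctuation field action is represented as the sum P^{(k)}(g_k, U_{k+1}, B) + {…} = Σ_{Y∈𝐃_k} V_k(Y, U_{k+1}, B)», the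
  localization being performed TERM BY TERM on the old terms ((1.23) p.7: «It is a sum over all admissible □₀, Y₀, j and X»); and [II] §2 (2.14) p.15
  carries the potentials inside `exp[Σ_{Y∈𝐃} τ(Y) V_k(Y, B)]` of the generic term.  Here, hypothesis-schema style: the ONE-STEP GENERATOR
  `W1.StepGen P 𝔸 M k` = g0's `ClusterStep` with the generic (2.14) term typed as a function `T i t old φ` of the last coupling `t` (complex: [I] p.263
  «(or analytic)», p.266) and of the OLDER TERMS `old : W1.OlderTerms P 𝔸 M k` (the configuration functionals `E^{(j)}(Y; ·)`, `j ≤ k`); its one-step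
  map `StepGen.E t old φ X` ((2.13) of the activities (2.11), DEFINITIONAL, the same `locE` literal as g0); the terms GENERATED BY THE RECURSION
  `recTerm G g (k+1) X φ = (G k).E (g k) (olderOf (recTerm G g) k) φ X` (`recTerm_succ` — THE display; well-founded recursion on the creation step, complex
  histories `g : ℕ → ℂ`); prefix dependence now a THEOREM of the recursion (`recTerm_congr_prefix`); the real reading `toClusterTower G : W1.ClusterTower P 𝔸 M`
  with `termC (toClusterTower G) j X g φ = recTerm G (↑g) j X φ` (`termC_toClusterTower`) — so every g0∕g2∕g3∕N18∕N22 statement over `ClusterTower` applies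
  to generated towers verbatim; the family-level strong-induction scaffold through the step map (`recTerm_levelInduction`).
  §3 READS ROAD 3 OF N22 ON THE OBJECT («uniform-margin analyticity in the OLDER couplings — printed TYPE for the last only», N22-ROADS-CENSUS): two
  per-step schemas — `StepGen.AnalyticInLast` (the new term analytic in its last coupling, [I] p.263) and `StepGen.PropagatesAnalyticity` (analytic
  dependence on a parameter passes from the older terms to the new term — the (1.41)∘(2.14) mechanism, NOT PRINTED as a statement) — and an admissibility
  bookkeeping `RecAdmissible`, from which **analyticity of every term in EVERY young coupling** follows by strong induction on W1's recursion
  (`analyticInEach_recTerm`; older levels do not read the coupling being varied — `recTerm_congr_prefix` — or are analytic in it by induction), and its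
  real-window reading `analyticInEachOfRecord_toClusterTower` = g0's `W1.AnalyticInEachOfRecord` ([I] p.266 «analytic functions of the effective coupling
  constants», typer NE-I's `AnalyticInEachCoupling266`) for the generated tower.  The schemas are asserted nowhere.
* (§4, v1.2) **THE SCHEMAS ASKED ONLY BELOW A RUN LENGTH** (dag-n22-e g4's socket, pub-ymgap bus 2026-08-27): the run of record on the `K`-th torus
  performs the steps `< K` only, so §3's hypotheses at the steps `≥ K` are «analyticity data about junk».  `RecAdmissibleBelow` (the bookkeeping at the
  steps `< K`), `analyticInLast_recTerm` (ONE step's (A-last) + bookkeeping ⟹ the new term analytic in its LAST coupling — [I] p.263's printed clause, no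
  induction, no (A-prop)), `analyticInEach_recTerm_of_lt` (§3's induction with the bound threaded: levels `j ≤ K` from the schemas at the steps `k < K`),
  and the real-window readings for the generated tower (`analyticInLastOfRecord_toClusterTower`) and for the run towers `truncRun K (toClusterTower G)` ∕
  `runTowers (fun k ↦ toClusterTower (G k)) k` (`analyticInEachOfRecord_truncRun_toClusterTower_of_lt`, `analyticInLastOfRecord_truncRun_toClusterTower_of_lt`,
  `analyticInEachOfRecord_runTowers_toClusterTower`, `analyticInLastOfRecord_runTowers_toClusterTower`).

HONEST SCOPE.  Total definitions, `rfl` faces and proved glue (case splits on the run length, strong induction on the creation step, Mathlib's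
`AnalyticOnNhd` calculus for the restriction to real couplings); 0 `sorry`, 0 `instance`, 0 `notation`, standard axioms.  NOTHING of [I]–[II] is
asserted: the generators `G`, the towers `S`, the admissible classes, the space tables and every schema are PARAMETERS ∕ HYPOTHESES.  The factorization of
the generic term through the potentials `V_k(Y, U_{k+1}, B)` of (1.41) (fluctuation field, Gaussian integrals, `Γ_k(Z₀, σ(Z))`) is NOT typed — `T`'s
dependence on the older terms is abstract (N10's Lemmas 1–3 ∕ NODE A own the integrand; g0's census V2 stands); the by-name reading of
`T4HistoryLipschitzRecursion`'s real-background channel shapes (`ChannelAdditive`, `OuterLipschitz`) on these complex objects is NOT an identity and is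
not made.  Count-neutral: no node of the 27 is discharged by this file.

REPAIR CENSUS (typing variants tried).  V1 older terms as the full prefix-indexed history functional `(ℕ → ℝ) → …` inside `T` — rejected: it re-admits
the dependence on `g₀, …, g_{k−1}` the object is meant to exclude.  V2 structural recursion with a `Fin.snoc` accumulator of all levels `≤ k` — equivalent;
the well-founded form gives the display `recTerm_succ` as the equation lemma and is kept.  V3 real last coupling `t : ℝ` — rejected for §3: analyticity
in `g_k` and in the older couplings wants complex histories; the real tower is the reading `toClusterTower` at `↑g`.  V4 «no term after the run» as a
hypothesis field of `ReadingData` — rejected: it is a property of the truncated towers of record, proved (§1), and `ReadingData.ofRecord` keeps its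
signature (consumers instantiate `S := runTowers S`).

References (TYPES and page anchors only): [I] = [Balaban1987RG1] T. Bałaban, *Renormalization group approach to lattice gauge field theories. I*,
Commun. Math. Phys. **109** (1987) 249–301 — (0.22)–(0.25) pp.256–257, (1.7) p.261, p.263, p.266, (2.12)–(2.13) p.268; [II] = [Balaban1988RG2Cluster]
*… II. Cluster expansions*, Commun. Math. Phys. **116** (1988) 1–22 — (1.23) p.7, (1.33)–(1.36) p.9, Lemma 2 (1.41)–(1.42) p.11, (2.9)–(2.14) pp.14–15;
[III] = [Balaban1988Convergent] (the frame of record, via `Node00.Sect2FrameOfRecord`).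
-/

open scoped BigOperators

noncomputable section

namespace Literature.MathematicalPhysics.QuantumFieldTheory.Balaban1983to89.Node00

open Literature.MathematicalPhysics.QuantumFieldTheory.Balaban1983to89
open Step B14.Eq213MaximalDomains TreeLengthTorus T4Continuum Sect2
open Literature.MathematicalPhysics.QuantumFieldTheory.Balaban1983to89.TreeLengthTorusGeometry (tgeometry)
open Literature.MathematicalPhysics.QuantumFieldTheory.Balaban1983to89.B12BetaHolo (EHoloAt)

namespace W1

/-! ## §1  Run length: the towers of the runs of record create no term after their last step ([I] (0.23)–(0.24)) -/

section RunLength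

variable {P : Params} {𝔸 : Type*} {M : ℕ}

/-- **THE RUN-LENGTH TRUNCATION OF A TOWER**: the one-step data of the steps `m < K` are kept, the steps `m ≥ K` are TERMLESS (g2's `termlessTower`:
no indices, `H ≡ 0`) — the run of `K` steps performs the steps `0, …, K − 1` and creates the terms of creation steps `1, …, K` ([I] (0.23):
«E_k = Σ_{j=1}^{k} …»). [cite: Balaban1987RG1, (0.23)-(0.24) pp.256-257] -/
def truncRun (K : ℕ) (S : ClusterTower P 𝔸 M) : ClusterTower P 𝔸 M :=
  fun m => if m < K then S m else termlessTower P 𝔸 M m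

/-- Below the run length the truncated tower is the tower. [cite: Balaban1987RG1, (0.23) p.256 (bookkeeping)] -/
theorem truncRun_of_lt {K m : ℕ} (S : ClusterTower P 𝔸 M) (h : m < K) : truncRun K S m = S m :=
  if_pos h

/-- At and beyond the run length the truncated tower is termless. [cite: Balaban1987RG1, (0.23) p.256 (bookkeeping)] -/
theorem truncRun_of_le {K m : ℕ} (S : ClusterTower P 𝔸 M) (h : K ≤ m) : truncRun K S m = termlessTower P 𝔸 M m :=
  if_neg (Nat.not_lt.2 h)

/-- Truncation is idempotent. [cite: Balaban1987RG1, (0.23) p.256 (bookkeeping)] -/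
theorem truncRun_truncRun (K : ℕ) (S : ClusterTower P 𝔸 M) : truncRun K (truncRun K S) = truncRun K S := by
  funext m
  by_cases h : m < K <;> simp [truncRun, h]

/-- **THE TERMS OF THE RUN UP TO ITS LENGTH ARE THE TOWER'S**: `E^{(j)}_{truncRun K S} = E^{(j)}_S` for `j ≤ K`. [cite: Balaban1987RG1, (0.23)-(0.24) pp.256-257] -/
theorem termC_truncRun_of_le {K j : ℕ} (S : ClusterTower P 𝔸 M) (h : j ≤ K) (X : (domSys P M j).Dom) (g : ℕ → ℝ) (φ : CPair P 𝔸) :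
    termC (truncRun K S) j X g φ = termC S j X g φ := by
  cases j with
  | zero => rfl
  | succ m => rw [termC_succ, termC_succ, truncRun_of_lt S (Nat.lt_of_succ_le h)]

/-- **NO TERM AFTER THE RUN**: `E^{(j)}_{truncRun K S} = 0` for `K < j` — the run of `K` steps creates nothing at the creation steps `j > K`.
[cite: Balaban1987RG1, (0.23)-(0.24) pp.256-257] -/
theorem termC_truncRun_eq_zero {K j : ℕ} (S : ClusterTower P 𝔸 M) (h : K < j) (X : (domSys P M j).Dom) (g : ℕ → ℝ) (φ : CPair P 𝔸) :
    termC (truncRun K S) j X g φ = 0 := by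
  cases j with
  | zero => rfl
  | succ m =>
    rw [termC_succ, truncRun_of_le S (Nat.le_of_lt_succ h)]
    exact E_termlessTower m _ φ X

/-- The (2.13) functional of the truncated tower below the run length. [cite: Balaban1987RG1, (0.24) p.257 (bookkeeping)] -/
theorem functionalC_truncRun_of_le {K : ℕ} (S : ClusterTower P 𝔸 M) (g : ℕ → ℝ) (φ : CPair P 𝔸) (X : W1.Dom P M) (h : X.1 ≤ K) :
    functionalC (truncRun K S) g φ X = functionalC S g φ X :=
  termC_truncRun_of_le S h X.2 g φ

/-- The (2.13) functional of the truncated tower vanishes beyond the run length. [cite: Balaban1987RG1, (0.24) p.257 (bookkeeping)] -/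
theorem functionalC_truncRun_eq_zero {K : ℕ} (S : ClusterTower P 𝔸 M) (g : ℕ → ℝ) (φ : CPair P 𝔸) (X : W1.Dom P M) (h : K < X.1) :
    functionalC (truncRun K S) g φ X = 0 :=
  termC_truncRun_eq_zero S h X.2 g φ

/-- **«THE TOWER CREATES NO TERM AFTER STEP `K`»** — the junk-freeness clause (J)∕(K0) of the N22 seats as a named property of a tower: every term of
creation step `j > K` vanishes identically (in the history, the domain and the configuration). [cite: Balaban1987RG1, (0.23)-(0.24) pp.256-257] -/
def TermlessBeyond (S : ClusterTower P 𝔸 M) (K : ℕ) : Prop :=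
  ∀ (j : ℕ) (X : (domSys P M j).Dom) (g : ℕ → ℝ) (φ : CPair P 𝔸), K < j → termC S j X g φ = 0

/-- The truncated tower creates no term after its run length. [cite: Balaban1987RG1, (0.23)-(0.24) pp.256-257] -/
theorem termlessBeyond_truncRun (K : ℕ) (S : ClusterTower P 𝔸 M) : TermlessBeyond (truncRun K S) K :=
  fun _ X g φ h => termC_truncRun_eq_zero S h X g φ

/-- The termless tower creates no term at all. [cite: Balaban1988RG2Cluster, (2.11) p.14 (bookkeeping; the empty instance)] -/
theorem termlessBeyond_termlessTower (K : ℕ) : TermlessBeyond (termlessTower P 𝔸 M) K :=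
  fun j X g φ _ => termC_termlessTower j X g φ

/-- Monotonicity in the run length. [cite: Balaban1987RG1, (0.23) p.256 (bookkeeping)] -/
theorem TermlessBeyond.mono {S : ClusterTower P 𝔸 M} {K K' : ℕ} (h : TermlessBeyond S K) (hK : K ≤ K') : TermlessBeyond S K' :=
  fun j X g φ hj => h j X g φ (lt_of_le_of_lt hK hj)

/-- A tower termless beyond `K` has vanishing (2.13) functional at every domain of creation step `> K`. [cite: Balaban1987RG1, (0.24) p.257 (bookkeeping)] -/
theorem TermlessBeyond.functionalC_eq_zero {S : ClusterTower P 𝔸 M} {K : ℕ} (h : TermlessBeyond S K) (g : ℕ → ℝ) (φ : CPair P 𝔸)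
    (X : W1.Dom P M) (hX : K < X.1) : functionalC S g φ X = 0 :=
  h X.1 X.2 g φ hX

/-- A tower termless beyond `K` agrees with its own truncation at `K` term by term. [cite: Balaban1987RG1, (0.23)-(0.24) pp.256-257 (bookkeeping)] -/
theorem TermlessBeyond.termC_truncRun_eq {S : ClusterTower P 𝔸 M} {K : ℕ} (h : TermlessBeyond S K) (j : ℕ) (X : (domSys P M j).Dom) (g : ℕ → ℝ)
    (φ : CPair P 𝔸) : termC (truncRun K S) j X g φ = termC S j X g φ := by
  rcases Nat.lt_or_ge K j with hj | hj
  · rw [termC_truncRun_eq_zero S hj, h j X g φ hj]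
  · exact termC_truncRun_of_le S hj X g φ

/-- (1.18)-type bounds survive truncation (the new zero terms obey any bound with a nonnegative constant). [cite: Balaban1987RG1, (1.18) p.263 (bookkeeping)] -/
theorem termBound118_truncRun {S : ClusterTower P 𝔸 M} {W : Set (ℕ → ℝ)} {sp : (j : ℕ) → (domSys P M j).Dom → Set (CPair P 𝔸)} {E₀ r : ℝ}
    (h : TermBound118 S W sp E₀ r) (hE : 0 ≤ E₀) (K : ℕ) : TermBound118 (truncRun K S) W sp E₀ r := by
  intro g hg j X φ hφ
  rcases Nat.lt_or_ge K j with hj | hj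
  · rw [termC_truncRun_eq_zero S hj, norm_zero]
    positivity
  · rw [termC_truncRun_of_le S hj]
    exact h g hg j X φ hφ

/-- Analyticity of the terms on a space table survives truncation. [cite: Balaban1987RG1, p.263 (analytic on U^c_j; bookkeeping)] -/
theorem termAnalytic_truncRun [NormedRing 𝔸] [NormedAlgebra ℂ 𝔸] {S : ClusterTower P 𝔸 M} {W : Set (ℕ → ℝ)}
    {sp : (j : ℕ) → (domSys P M j).Dom → Set (CPair P 𝔸)} (h : TermAnalytic S W sp) (K : ℕ) : TermAnalytic (truncRun K S) W sp := by
  intro g hg j X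
  rcases Nat.lt_or_ge K j with hj | hj
  · have : termC (truncRun K S) j X g = fun _ => 0 := funext fun φ => termC_truncRun_eq_zero S hj X g φ
    rw [this]
    exact analyticOnNhd_const
  · have : termC (truncRun K S) j X g = termC S j X g := funext fun φ => termC_truncRun_of_le S hj X g φ
    rw [this]
    exact h g hg j X

/-- Case eliminator for per-step properties of a truncated tower: the kept steps are the tower's, the others termless.
[cite: Balaban1987RG1, (0.23) p.256 (bookkeeping)] -/
theorem truncRun_cases {K : ℕ} (S : ClusterTower P 𝔸 M) {Q : (m : ℕ) → ClusterStep P 𝔸 M m → Prop} (hS : ∀ m < K, Q m (S m))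
    (h0 : ∀ m, K ≤ m → Q m (termlessTower P 𝔸 M m)) (m : ℕ) : Q m (truncRun K S m) := by
  rcases Nat.lt_or_ge m K with h | h
  · rw [truncRun_of_lt S h]
    exact hS m h
  · rw [truncRun_of_le S h]
    exact h0 m h

/-- The ‖E′‖ bound of record survives truncation (nonnegative constant). [cite: Balaban1987RG1, §1 p.263 and (1.18) (bookkeeping)] -/
theorem termDerivBound_truncRun [NormedRing 𝔸] [NormedAlgebra ℂ 𝔸] {S : ClusterTower P 𝔸 M} {W : Set (ℕ → ℝ)}
    {sp : (j : ℕ) → (domSys P M j).Dom → Set (CPair P 𝔸)} {E₁ r : ℝ} (h : TermDerivBound S W sp E₁ r) (hE : 0 ≤ E₁) (K : ℕ) :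
    TermDerivBound (truncRun K S) W sp E₁ r := by
  intro g hg j X
  rcases Nat.lt_or_ge K j with hj | hj
  · have : termC (truncRun K S) j X g = fun _ => 0 := funext fun φ => termC_truncRun_eq_zero S hj X g φ
    rw [this]
    intro φ _
    refine ⟨differentiableAt_const _, ?_⟩
    have h0 : fderiv ℂ (fun _ : CPair P 𝔸 => (0 : ℂ)) φ = 0 := by simp
    rw [h0, ContinuousLinearMap.opNorm_zero]
    positivity
  · have : termC (truncRun K S) j X g = termC S j X g := funext fun φ => termC_truncRun_of_le S hj X g φ
    rw [this]
    exact h g hg j X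

/-- [I] p.263's `C^∞` clause in the last coupling survives truncation (the zero sections are smooth). [cite: Balaban1987RG1, §1 p.263 (bookkeeping)] -/
theorem smoothInLastOfRecord_truncRun [NormedRing 𝔸] [NormedAlgebra ℂ 𝔸] {S : ClusterTower P 𝔸 M} {W : Set (ℕ → ℝ)} {I : Set ℝ}
    {sp : (j : ℕ) → (domSys P M j).Dom → Set (CPair P 𝔸)} (h : SmoothInLastOfRecord S W I sp) (K : ℕ) :
    SmoothInLastOfRecord (truncRun K S) W I sp := by
  intro X φ hφ g hg i hi n
  rcases Nat.lt_or_ge K X.1 with hX | hX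
  · have : (fun s : ℝ => functionalC (truncRun K S) (Function.update g i s) φ X) = fun _ => 0 :=
      funext fun s => functionalC_truncRun_eq_zero S _ φ X hX
    rw [this]
    exact contDiffOn_const
  · have : (fun s : ℝ => functionalC (truncRun K S) (Function.update g i s) φ X) = fun s => functionalC S (Function.update g i s) φ X :=
      funext fun s => functionalC_truncRun_of_le S _ φ X hX
    rw [this]
    exact h X φ hφ g hg i hi n

/-- [I] p.266's coordinatewise analyticity clause survives truncation (the zero sections are analytic). [cite: Balaban1987RG1, p.266 (bookkeeping)] -/
theorem analyticInEachOfRecord_truncRun [NormedRing 𝔸] [NormedAlgebra ℂ 𝔸] {S : ClusterTower P 𝔸 M} {W : Set (ℕ → ℝ)} {I : Set ℝ}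
    {sp : (j : ℕ) → (domSys P M j).Dom → Set (CPair P 𝔸)} (h : AnalyticInEachOfRecord S W I sp) (K : ℕ) :
    AnalyticInEachOfRecord (truncRun K S) W I sp := by
  intro X φ hφ g hg i hi
  rcases Nat.lt_or_ge K X.1 with hX | hX
  · have : (fun s : ℝ => functionalC (truncRun K S) (Function.update g i s) φ X) = fun _ => 0 :=
      funext fun s => functionalC_truncRun_eq_zero S _ φ X hX
    rw [this]
    exact analyticOnNhd_const.analyticOn
  · have : (fun s : ℝ => functionalC (truncRun K S) (Function.update g i s) φ X) = fun s => functionalC S (Function.update g i s) φ X :=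
      funext fun s => functionalC_truncRun_of_le S _ φ X hX
    rw [this]
    exact h X φ hφ g hg i hi

/-- The analytic last-coupling clause (g3's `AnalyticInLastOfRecord`) survives truncation. [cite: Balaban1987RG1, §1 p.263 «(or analytic)» (bookkeeping)] -/
theorem analyticInLastOfRecord_truncRun [NormedRing 𝔸] [NormedAlgebra ℂ 𝔸] [CompleteSpace 𝔸] {S : ClusterTower P 𝔸 M} {W : Set (ℕ → ℝ)}
    {I : Set ℝ} {sp : (j : ℕ) → (domSys P M j).Dom → Set (CPair P 𝔸)} (h : AnalyticInLastOfRecord S W I sp) (K : ℕ) :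
    AnalyticInLastOfRecord (truncRun K S) W I sp := by
  intro X φ hφ g hg i hi
  rcases Nat.lt_or_ge K X.1 with hX | hX
  · have : (fun s : ℝ => functionalC (truncRun K S) (Function.update g i s) φ X) = fun _ => 0 :=
      funext fun s => functionalC_truncRun_eq_zero S _ φ X hX
    rw [this]
    exact analyticOnNhd_const.analyticOn
  · have : (fun s : ℝ => functionalC (truncRun K S) (Function.update g i s) φ X) = fun s => functionalC S (Function.update g i s) φ X :=
      funext fun s => functionalC_truncRun_of_le S _ φ X hX
    rw [this]
    exact h X φ hφ g hg i hi

variable {F : T4Family}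

/-- **THE TOWERS OF THE RUNS OF RECORD**: run length `k` ↦ the tower `S k` of the `k`-th torus truncated at `k` — the run of `k` steps creates the terms of
creation steps `1, …, k` only ([I] (0.23)–(0.24); g2∕g3's `ReadingData.ofRecord` takes these per-run-length towers as its `S`).
[cite: Balaban1987RG1, (0.23)-(0.24) pp.256-257] -/
def runTowers (S : (k : ℕ) → ClusterTower (F.P k) 𝔸 M) : (k : ℕ) → ClusterTower (F.P k) 𝔸 M :=
  fun k => truncRun k (S k)

/-- Face: the run-length-`k` tower of record is the truncation at `k`. [cite: Balaban1987RG1, (0.23) p.256 (bookkeeping)] -/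
theorem runTowers_apply (S : (k : ℕ) → ClusterTower (F.P k) 𝔸 M) (k : ℕ) : runTowers S k = truncRun k (S k) := rfl

/-- The run of `k` steps of record creates no term after step `k`. [cite: Balaban1987RG1, (0.23)-(0.24) pp.256-257] -/
theorem termlessBeyond_runTowers (S : (k : ℕ) → ClusterTower (F.P k) 𝔸 M) (k : ℕ) : TermlessBeyond (runTowers S k) k :=
  termlessBeyond_truncRun k (S k)

/-- **(J)∕(K0) FOR A READING DATUM WHOSE TOWERS ARE TERMLESS BEYOND THE RUN LENGTH** — dag-n22-c g3's displayed clause `hjunk` literally: run A's level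
functional of the run of `k` steps vanishes at every domain of creation step `> k`, for every history and background (any pairing data, any reading
maps). [cite: Balaban1987RG1, (0.23)-(0.24) pp.256-257 and (1.18) p.263 (bookkeeping)] -/
theorem ReadingData.EA_eq_zero_of_termlessBeyond (D : ReadingData F 𝔸 M) (h : ∀ k, TermlessBeyond (D.S k) k) (k : ℕ) (g : ℕ → ℝ)
    (U : (D.pairing k).BgA) (X : W1.Dom (F.P k) M) (hX : k < X.1) : (D.pairing k).EA (D.S k) g U X = 0 := by
  rw [LevelPairing.EA_apply, (h k).functionalC_eq_zero g _ X hX, Complex.zero_re]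

/-- The same on the U3 objects of the reading (dag-n22-e g3's (K0) «k < j ⇒ Re E^{(j)}_{S k}(X; ·; ·) = 0»). [cite: Balaban1987RG1, (0.23)-(0.24) pp.256-257 (bookkeeping)] -/
theorem ReadingData.u3Objects_EA_eq_zero_of_termlessBeyond (D : ReadingData F 𝔸 M) (γ : ℝ) (h : ∀ k, TermlessBeyond (D.S k) k) (k : ℕ)
    (g : ℕ → ℝ) (U : (D.pairing k).BgA) (X : W1.Dom (F.P k) M) (hX : k < X.1) : (D.u3Objects γ).EA k g U X = 0 :=
  ReadingData.EA_eq_zero_of_termlessBeyond D h k g U X hX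

/-- **(J)∕(K0) AT THE READING OF RECORD ON THE TOWERS OF THE RUNS OF RECORD**: for `ReadingData.ofRecord F M N (runTowers S) gauge hg T₀ li`, run A's
level-`k` functional vanishes at every `(j, X)` with `j > k`. [cite: Balaban1987RG1, (0.23)-(0.24) pp.256-257 (bookkeeping)] -/
theorem ReadingData.EA_ofRecord_runTowers_eq_zero (N : ℕ) (S : (k : ℕ) → ClusterTower (F.P k) (MatA N) M)
    (gauge : (k : ℕ) → GaugeField (F.P k) 0 (SU N) → GaugeField (F.P k) 0 (SU N) → ℝ) (hg : ∀ k U U', 0 ≤ gauge k U U')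
    (transport : (k : ℕ) → GaugeField (F.P (k + 1)) 0 (SU N) → GaugeField (F.P k) 0 (SU N)) (li : LetterInputs) (k : ℕ) (g : ℕ → ℝ)
    (U : GaugeField (F.P k) 0 (SU N)) (X : W1.Dom (F.P k) M) (hX : k < X.1) :
    ((ReadingData.ofRecord F M N (runTowers S) gauge hg transport li).pairing k).EA
        ((ReadingData.ofRecord F M N (runTowers S) gauge hg transport li).S k) g U X = 0 :=
  ReadingData.EA_eq_zero_of_termlessBeyond (ReadingData.ofRecord F M N (runTowers S) gauge hg transport li)
    (fun k => termlessBeyond_runTowers S k) k g U X hX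

/-- … and the run-A value below the run length is the untruncated tower's (2.13) term read at `(ιU, 0)`. [cite: Balaban1987RG1, (0.24) p.257 (bookkeeping)] -/
theorem ReadingData.EA_ofRecord_runTowers_of_le (N : ℕ) (S : (k : ℕ) → ClusterTower (F.P k) (MatA N) M)
    (gauge : (k : ℕ) → GaugeField (F.P k) 0 (SU N) → GaugeField (F.P k) 0 (SU N) → ℝ) (hg : ∀ k U U', 0 ≤ gauge k U U')
    (transport : (k : ℕ) → GaugeField (F.P (k + 1)) 0 (SU N) → GaugeField (F.P k) 0 (SU N)) (li : LetterInputs) (k : ℕ) (g : ℕ → ℝ)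
    (U : GaugeField (F.P k) 0 (SU N)) (X : W1.Dom (F.P k) M) (hX : X.1 ≤ k) :
    ((ReadingData.ofRecord F M N (runTowers S) gauge hg transport li).pairing k).EA
        ((ReadingData.ofRecord F M N (runTowers S) gauge hg transport li).S k) g U X =
      (functionalC (S k) g (ofBackgroundC (ιSU N) U) X).re := by
  rw [LevelPairing.EA_apply]
  exact congrArg Complex.re (functionalC_truncRun_of_le (S k) g _ X hX)

end RunLength

/-! ### Node N09's per-step currency `EHoloAt` under truncation (g3's `sfTowerOfRecord` ∕ `eHoloAtOfRecord`) -/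

section SFTrunc

variable {P : Params} {𝔸 : Type*} [NormedRing 𝔸] [NormedAlgebra ℂ 𝔸] [CompleteSpace 𝔸] {G : Type*} [GaugeGroup G] {M : ℕ}
variable (Sg : Setting 𝔸 G) (Rz : Residual P 𝔸) (S : ClusterTower P 𝔸 M) (fl : Flow) (logZ : ℕ → GaugeField P 0 G → ℝ)

/-- **`EHoloAt` BELOW THE RUN LENGTH TRANSFERS TO THE TRUNCATED TOWER** (same new term `E^{(k+1)}` for `k + 1 ≤ K`; every field of the datum kept — the
cross-tower fields are routed through their tower-free forms, cf. g3's `termC_update_eq_of_eHoloAt`).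
[cite: Balaban1987RG1, p.263 (clause before (1.18)) and (0.23) p.256 (bookkeeping)] -/
def eHoloAtTruncRun {c : SFConsts} {k K : ℕ} (H : EHoloAt (sfTowerOfRecord Sg Rz M S fl logZ) c k) (hk : k + 1 ≤ K) :
    EHoloAt (sfTowerOfRecord Sg Rz M (truncRun K S) fl logZ) c k :=
  have hholo : ∀ (X : (domSys P M (k + 1)).Dom) (φ : CPair P 𝔸), φ ∈ spaceI Sg Rz M (k + 1) (domSites P M (k + 1) X) c.α₀ c.α₁ →
      DifferentiableOn ℂ (H.Ec X φ) H.U := H.holo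
  have hbound : ∀ (X : (domSys P M (k + 1)).Dom) (φ : CPair P 𝔸), φ ∈ spaceI Sg Rz M (k + 1) (domSites P M (k + 1) X) c.α₀ c.α₁ →
      ∀ z ∈ H.U, ‖H.Ec X φ z‖ ≤ H.E₀ * Real.exp (-c.κ * torusTreeLen (Subtype.val X : Finset (TPt P.d (domCount P M (k + 1))))) := H.bound
  eHoloAtOfRecord Sg Rz M (truncRun K S) fl logZ c k H.U H.isOpen H.r H.r_pos H.ball_subset H.Ec hholo
    (fun X φ hφ _ ht => (termC_truncRun_of_le S hk X _ φ).trans (termC_update_eq_of_eHoloAt Sg Rz M S fl logZ H X φ hφ ht)) H.E₀ hbound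

/-- Face: the (1.18) constant is kept. [cite: Balaban1987RG1, (1.18) p.263 (bookkeeping)] -/
theorem eHoloAtTruncRun_E₀ {c : SFConsts} {k K : ℕ} (H : EHoloAt (sfTowerOfRecord Sg Rz M S fl logZ) c k) (hk : k + 1 ≤ K) :
    (eHoloAtTruncRun Sg Rz S fl logZ H hk).E₀ = H.E₀ := by
  unfold eHoloAtTruncRun eHoloAtOfRecord
  rfl

/-- Face: the margin is kept. [cite: Balaban1987RG1, p.263 (bookkeeping)] -/
theorem eHoloAtTruncRun_r {c : SFConsts} {k K : ℕ} (H : EHoloAt (sfTowerOfRecord Sg Rz M S fl logZ) c k) (hk : k + 1 ≤ K) :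
    (eHoloAtTruncRun Sg Rz S fl logZ H hk).r = H.r := by
  unfold eHoloAtTruncRun eHoloAtOfRecord
  rfl

/-- **BEYOND THE RUN LENGTH THE NEW TERM IS `0`**: its `EHoloAt` datum is the zero extension to the whole coupling plane, with ANY margin `r > 0` and the
(1.18) constant `0`. [cite: Balaban1987RG1, (0.23)-(0.24) pp.256-257 (bookkeeping)] -/
def eHoloAtTruncRunZero (c : SFConsts) {k K : ℕ} (hk : K < k + 1) (r : ℝ) (hr : 0 < r) :
    EHoloAt (sfTowerOfRecord Sg Rz M (truncRun K S) fl logZ) c k :=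
  eHoloAtOfRecord Sg Rz M (truncRun K S) fl logZ c k Set.univ isOpen_univ r hr (fun _ _ => Set.subset_univ _) (fun _ _ _ => 0)
    (fun _ _ _ => differentiableOn_const 0) (fun X φ _ _ _ => termC_truncRun_eq_zero S hk X _ φ) 0
    (fun _ _ _ _ _ => by simp)

/-- Face: the (1.18) constant beyond the run is `0`. [cite: Balaban1987RG1, (1.18) p.263 (bookkeeping)] -/
theorem eHoloAtTruncRunZero_E₀ (c : SFConsts) {k K : ℕ} (hk : K < k + 1) (r : ℝ) (hr : 0 < r) :
    (eHoloAtTruncRunZero Sg Rz S fl logZ c hk r hr).E₀ = 0 := by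
  unfold eHoloAtTruncRunZero eHoloAtOfRecord
  rfl

/-- Face: the margin beyond the run is the chosen one. [cite: Balaban1987RG1, p.263 (bookkeeping)] -/
theorem eHoloAtTruncRunZero_r (c : SFConsts) {k K : ℕ} (hk : K < k + 1) (r : ℝ) (hr : 0 < r) :
    (eHoloAtTruncRunZero Sg Rz S fl logZ c hk r hr).r = r := by
  unfold eHoloAtTruncRunZero eHoloAtOfRecord
  rfl

/-- **A FAMILY OF `EHoloAt`'s WITH UNIFORM `(E₀, r)` BELOW THE RUN LENGTH GIVES ONE AT EVERY LEVEL OF THE TRUNCATED TOWER** (the SHARP form, asked by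
dag-n22-c g4: the steps `≥ K` of the untruncated tower are not of record, so the holomorphic currency is asked for only below the run length; `0 ≤ E₀`
serves the zero terms beyond it). [cite: Balaban1987RG1, (1.18) p.263 and Thm 1 p.259 (bookkeeping)] -/
theorem exists_eHoloAt_truncRun_of_lt (c : SFConsts) (β : ℕ → ℝ → ℝ) {W : Set (ℕ → ℝ)} {E₀ r : ℝ} (hE₀ : 0 ≤ E₀) (hr : 0 < r) (K : ℕ)
    (hE : ∀ g ∈ W, ∀ k : ℕ, k + 1 ≤ K → ∃ H : EHoloAt (sfTowerOfRecord Sg Rz M S ⟨g, β⟩ logZ) c k, H.E₀ ≤ E₀ ∧ r ≤ H.r) :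
    ∀ g ∈ W, ∀ k : ℕ, ∃ H : EHoloAt (sfTowerOfRecord Sg Rz M (truncRun K S) ⟨g, β⟩ logZ) c k, H.E₀ ≤ E₀ ∧ r ≤ H.r := by
  intro g hg k
  rcases Nat.lt_or_ge K (k + 1) with hk | hk
  · refine ⟨eHoloAtTruncRunZero Sg Rz S ⟨g, β⟩ logZ c hk r hr, ?_, ?_⟩
    · rw [eHoloAtTruncRunZero_E₀]; exact hE₀
    · rw [eHoloAtTruncRunZero_r]
  · obtain ⟨H, h₁, h₂⟩ := hE g hg k hk
    refine ⟨eHoloAtTruncRun Sg Rz S ⟨g, β⟩ logZ H hk, ?_, ?_⟩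
    · rw [eHoloAtTruncRun_E₀]; exact h₁
    · rw [eHoloAtTruncRun_r]; exact h₂

/-- **A FAMILY OF `EHoloAt`'s WITH UNIFORM `(E₀, r)` ALONG A HISTORY SET SURVIVES TRUNCATION** (all-levels corollary; the shape of dag-n22-c's socket
`hE` ∕ g3's `lastOut_of_eHoloAt` premise). [cite: Balaban1987RG1, (1.18) p.263 and Thm 1 p.259 (bookkeeping)] -/
theorem exists_eHoloAt_truncRun (c : SFConsts) (β : ℕ → ℝ → ℝ) {W : Set (ℕ → ℝ)} {E₀ r : ℝ} (hE₀ : 0 ≤ E₀) (hr : 0 < r)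
    (hE : ∀ g ∈ W, ∀ k : ℕ, ∃ H : EHoloAt (sfTowerOfRecord Sg Rz M S ⟨g, β⟩ logZ) c k, H.E₀ ≤ E₀ ∧ r ≤ H.r) (K : ℕ) :
    ∀ g ∈ W, ∀ k : ℕ, ∃ H : EHoloAt (sfTowerOfRecord Sg Rz M (truncRun K S) ⟨g, β⟩ logZ) c k, H.E₀ ≤ E₀ ∧ r ≤ H.r :=
  exists_eHoloAt_truncRun_of_lt Sg Rz S logZ c β hE₀ hr K fun g hg k _ => hE g hg k

end SFTrunc

/-! ## §2  The one-step generator and the terms generated by the recursion ([I] (2.12)–(2.13), [II] (1.41), (2.14)) -/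

section Recursion

variable {P : Params} {𝔸 : Type*} {M : ℕ}

/-- **THE OLDER TERMS AT STEP `k`**: the configuration functionals `E^{(j)}(Y; ·) : Φ → ℂ` of the creation steps `j ≤ k` (level `0` carries no term,
[I] (0.23)) — the data through which, and ONLY through which, the couplings `g₀, …, g_{k−1}` enter the step ([I] p.256, (2.12)–(2.13) p.268).
[cite: Balaban1987RG1, (0.22)-(0.23) p.256 and (2.12)-(2.13) p.268] -/
abbrev OlderTerms (P : Params) (𝔸 : Type*) (M k : ℕ) :=
  (j : Fin (k + 1)) → (domSys P M j).Dom → CPair P 𝔸 → ℂ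

/-- The older terms at step `k` of a family of configuration functionals of all levels: restriction to the levels `≤ k`.
[cite: Balaban1987RG1, (0.23) p.256 (bookkeeping)] -/
def olderOf (E : (j : ℕ) → (domSys P M j).Dom → CPair P 𝔸 → ℂ) (k : ℕ) : OlderTerms P 𝔸 M k :=
  fun j => E j

/-- Face: `olderOf E k j = E j`. [cite: Balaban1987RG1, (0.23) p.256 (bookkeeping)] -/
@[simp] theorem olderOf_apply (E : (j : ℕ) → (domSys P M j).Dom → CPair P 𝔸 → ℂ) (k : ℕ) (j : Fin (k + 1)) : olderOf E k j = E j := rfl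

/-- **THE ONE-STEP GENERATOR AT STEP `k`** (hypothesis-schema; W1's history-dependence object): g0's one-step cluster data — the multi-indices
`(Z₀, 𝐃, P, …)` of (2.9), (2.1), (2.3) as `Idx`, the indices localizing at `Z ∈ 𝐃_{k+1}` ((2.10)) — with the generic term (2.14) typed as a function
`T i t old φ` of the LAST coupling `t = g_k` (complex, for [I] p.263 «(or analytic)» and p.266) and of the OLDER TERMS `old = (E^{(j)}(Y; ·))_{j≤k}`
(entering in print through the potentials `V_k(Y, U_{k+1}, B)` of [II] (1.41) inside `exp[Σ_Y τ(Y)V_k(Y, B)]` of (2.14); that factorization is not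
typed), at the configuration `φ = (𝐔, 𝐉) ∈ Φ` of record. [cite: Balaban1988RG2Cluster, (1.41) p.11, (2.9)-(2.11) p.14 and (2.14) p.15; Balaban1987RG1, (2.12)-(2.13) p.268] -/
structure StepGen (P : Params) (𝔸 : Type*) (M k : ℕ) where
  /-- the multi-indices `(Z₀, 𝐃, P, …)` of (2.9), (2.1), (2.3) -/
  Idx : Type
  /-- the indices localizing at `Z ∈ 𝐃_{k+1}` ((2.10)) -/
  idx : (domSys P M (k + 1)).Dom → Finset Idx
  /-- the generic term (2.14) from the last coupling `g_k`, the older terms `(E^{(j)})_{j≤k}` and the configuration `(𝐔, 𝐉)` -/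
  T : Idx → ℂ → OlderTerms P 𝔸 M k → CPair P 𝔸 → ℂ

namespace StepGen

variable {k : ℕ} (G : StepGen P 𝔸 M k)

/-- **THE ACTIVITY `H(Z)` OF THE STEP** ((2.11): the sum of the generic terms localizing at `Z`) from the last coupling and the older terms.
[cite: Balaban1988RG2Cluster, (2.9)-(2.11) p.14] -/
def H (t : ℂ) (old : OlderTerms P 𝔸 M k) (φ : CPair P 𝔸) (Z : (domSys P M (k + 1)).Dom) : ℂ :=
  ∑ i ∈ G.idx Z, G.T i t old φ

open Classical in
/-- **THE ONE-STEP MAP `(g_k, (E^{(j)})_{j≤k}) ↦ E^{(k+1)}(X; ·)`**: (2.13) p.14 of the activities — DEFINITIONAL, the same Kotecký–Preiss literal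
`B13Resummation.locE` on the torus polymer geometry of `𝐃_{k+1}` as g0's `ClusterStep.E`. [cite: Balaban1988RG2Cluster, (2.13) p.14; Balaban1987RG1, (2.13) p.268] -/
def E (t : ℂ) (old : OlderTerms P 𝔸 M k) (φ : CPair P 𝔸) (X : (domSys P M (k + 1)).Dom) : ℂ :=
  B13Resummation.locE (tgeometry P.d (domCount P M (k + 1))).ι (tgeometry P.d (domCount P M (k + 1))).cubes (fun Z => G.H t old φ Z)
    (Subtype.val X)

open Classical in
/-- `E^{(k+1)}(X)` depends on the activities only: equal activities give equal terms. [cite: Balaban1988RG2Cluster, (2.13) p.14 (bookkeeping)] -/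
theorem E_congr {t t' : ℂ} {old old' : OlderTerms P 𝔸 M k} {φ φ' : CPair P 𝔸} (X : (domSys P M (k + 1)).Dom)
    (h : ∀ Z, G.H t old φ Z = G.H t' old' φ' Z) : G.E t old φ X = G.E t' old' φ' X :=
  B13Resummation.locE_congr _ fun Z _ => h Z

end StepGen

/-- **A GENERATOR TOWER**: one one-step generator per step `k = 0, 1, 2, …`. [cite: Balaban1987RG1, (2.12)-(2.13) p.268 (every step)] -/
abbrev GenTower (P : Params) (𝔸 : Type*) (M : ℕ) := ∀ k, StepGen P 𝔸 M k

/-- **THE TERMS GENERATED BY THE RECURSION** at a (complex) coupling history `g`: `E^{(0)} = 0` (no term before the first step, [I] (0.23)) and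
`E^{(k+1)}(X; ·) = (one-step map at step k)(g_k, (E^{(j)})_{j≤k})(X; ·)` ([I] (2.13) p.268) — well-founded recursion on the creation step.
[cite: Balaban1987RG1, (0.23) p.256 and (2.12)-(2.13) p.268; Balaban1988RG2Cluster, (2.13)-(2.14) pp.14-15] -/
def recTerm (G : GenTower P 𝔸 M) (g : ℕ → ℂ) : (j : ℕ) → (domSys P M j).Dom → CPair P 𝔸 → ℂ
  | 0 => fun _ _ => 0
  | k + 1 => fun X φ => (G k).E (g k) (fun j : Fin (k + 1) => recTerm G g j) φ X
termination_by j => j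
decreasing_by exact j.2

/-- No term before the first step. [cite: Balaban1987RG1, (0.23) p.256] -/
@[simp] theorem recTerm_zero (G : GenTower P 𝔸 M) (g : ℕ → ℂ) (X : (domSys P M 0).Dom) (φ : CPair P 𝔸) : recTerm G g 0 X φ = 0 := by
  simp [recTerm]

/-- **THE W1 RECURSION** (the display): the term created at step `k + 1` is the one-step map at the LAST coupling `g_k` and the OLDER TERMS
`(E^{(j)})_{j≤k}` — the earlier couplings enter through the older terms only, BY CONSTRUCTION. [cite: Balaban1987RG1, (2.12)-(2.13) p.268; Balaban1988RG2Cluster, (1.41) p.11 and (2.14) p.15] -/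
theorem recTerm_succ (G : GenTower P 𝔸 M) (g : ℕ → ℂ) (k : ℕ) (X : (domSys P M (k + 1)).Dom) (φ : CPair P 𝔸) :
    recTerm G g (k + 1) X φ = (G k).E (g k) (olderOf (recTerm G g) k) φ X := by
  rw [recTerm]
  rfl

/-- **PREFIX DEPENDENCE IS A THEOREM OF THE RECURSION**: the term of creation step `j` reads `g₀, …, g_{j−1}` only ([I] p.256) — by strong induction:
step `k + 1` reads `g_k` and the older levels, which read `g₀, …, g_{k−1}`. [cite: Balaban1987RG1, §0 p.256 and (2.13) p.268] -/
theorem recTerm_congr_prefix (G : GenTower P 𝔸 M) {g g' : ℕ → ℂ} :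
    ∀ (j : ℕ), (∀ i < j, g i = g' i) → ∀ (X : (domSys P M j).Dom) (φ : CPair P 𝔸), recTerm G g j X φ = recTerm G g' j X φ := by
  intro j
  induction j using Nat.strong_induction_on with
  | _ j ih =>
    intro h X φ
    cases j with
    | zero => simp
    | succ k =>
      rw [recTerm_succ, recTerm_succ, h k (Nat.lt_succ_self k)]
      refine congrArg (fun old => (G k).E (g' k) old φ X) ?_
      funext j' Y ψ
      exact ih j'.1 j'.2 (fun i hi => h i (lt_trans hi j'.2)) Y ψ

/-- **THE FAMILY-LEVEL INDUCTION SCAFFOLD THROUGH THE STEP MAP**: a property of the coupling-history families `g ↦ E^{(j)}(X; g; ·)` holding for the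
zero family at level `0` and passing from all levels `≤ k` to the one-step map's output at level `k + 1` holds at every level.  (The usage pattern for
history-regularity statements — Lipschitz ∕ analytic in the couplings — on generated towers.) [cite: Balaban1987RG1, (2.13) p.268 (the inductive definition)] -/
theorem recTerm_levelInduction (G : GenTower P 𝔸 M) {Q : (j : ℕ) → (domSys P M j).Dom → ((ℕ → ℂ) → CPair P 𝔸 → ℂ) → Prop}
    (h0 : ∀ X : (domSys P M 0).Dom, Q 0 X fun _ _ => 0)
    (hstep : ∀ k : ℕ, (∀ j ≤ k, ∀ Y : (domSys P M j).Dom, Q j Y fun g φ => recTerm G g j Y φ) →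
      ∀ X : (domSys P M (k + 1)).Dom, Q (k + 1) X fun g φ => (G k).E (g k) (olderOf (recTerm G g) k) φ X) :
    ∀ (j : ℕ) (X : (domSys P M j).Dom), Q j X fun g φ => recTerm G g j X φ := by
  intro j
  induction j using Nat.strong_induction_on with
  | _ j ih =>
    intro X
    cases j with
    | zero =>
      have : (fun (g : ℕ → ℂ) (φ : CPair P 𝔸) => recTerm G g 0 X φ) = fun _ _ => 0 := by
        funext g φ
        exact recTerm_zero G g X φ
      rw [this]
      exact h0 X
    | succ k =>
      have : (fun (g : ℕ → ℂ) (φ : CPair P 𝔸) => recTerm G g (k + 1) X φ) = fun g φ => (G k).E (g k) (olderOf (recTerm G g) k) φ X := by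
        funext g φ
        exact recTerm_succ G g k X φ
      rw [this]
      exact hstep k (fun j hj Y => ih j (Nat.lt_succ_of_le hj) Y) X

/-! ### §2b  The real reading: the `ClusterTower` of a generator and its terms -/

/-- The complex history of a real young-coupling prefix `(g₀, …, g_k)` (zero beyond; the levels `≤ k + 1` never read beyond).
[cite: Balaban1987RG1, §0 p.256 (bookkeeping)] -/
def histOfPrefix {k : ℕ} (gk : Fin (k + 1) → ℝ) : ℕ → ℂ :=
  fun n => if h : n < k + 1 then ((gk ⟨n, h⟩ : ℝ) : ℂ) else 0

/-- `histOfPrefix` below the prefix length. [cite: Balaban1987RG1, §0 p.256 (bookkeeping)] -/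
theorem histOfPrefix_apply_lt {k : ℕ} (gk : Fin (k + 1) → ℝ) {n : ℕ} (h : n < k + 1) : histOfPrefix gk n = ((gk ⟨n, h⟩ : ℝ) : ℂ) :=
  dif_pos h

/-- `histOfPrefix` of the prefix of a real history is the history (as complex numbers) below the prefix length. [cite: Balaban1987RG1, §0 p.256 (bookkeeping)] -/
theorem histOfPrefix_restrictPrefix {k : ℕ} (g : ℕ → ℝ) {n : ℕ} (h : n < k + 1) : histOfPrefix (restrictPrefix k g) n = ((g n : ℝ) : ℂ) := by
  rw [histOfPrefix_apply_lt _ h, restrictPrefix_apply]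

/-- **THE TOWER OF ONE-STEP CLUSTER DATA OF A GENERATOR** (the real reading, g0's currency): at step `k` the same indices, and the generic term at the
real young prefix `(g₀, …, g_k)` := the generator's term at the last coupling `g_k` and the older terms GENERATED from `g₀, …, g_{k−1}`.
[cite: Balaban1988RG2Cluster, (2.14) p.15; Balaban1987RG1, (2.13) p.268] -/
def toClusterTower (G : GenTower P 𝔸 M) : ClusterTower P 𝔸 M :=
  fun k => ⟨(G k).Idx, (G k).idx, fun i gk φ => (G k).T i ((gk (Fin.last k) : ℝ) : ℂ) (olderOf (recTerm G (histOfPrefix gk)) k) φ⟩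

/-- Face: the activity of the generated step. [cite: Balaban1988RG2Cluster, (2.11) p.14 (bookkeeping)] -/
theorem toClusterTower_H (G : GenTower P 𝔸 M) (k : ℕ) (gk : Fin (k + 1) → ℝ) (φ : CPair P 𝔸) (Z : (domSys P M (k + 1)).Dom) :
    (toClusterTower G k).H gk φ Z = (G k).H ((gk (Fin.last k) : ℝ) : ℂ) (olderOf (recTerm G (histOfPrefix gk)) k) φ Z :=
  rfl

/-- Face: (2.13) of the generated step is the one-step map at the last coupling and the generated older terms (`rfl`: one `locE` literal).
[cite: Balaban1988RG2Cluster, (2.13) p.14 (bookkeeping)] -/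
theorem toClusterTower_E (G : GenTower P 𝔸 M) (k : ℕ) (gk : Fin (k + 1) → ℝ) (φ : CPair P 𝔸) (X : (domSys P M (k + 1)).Dom) :
    (toClusterTower G k).E gk φ X = (G k).E ((gk (Fin.last k) : ℝ) : ℂ) (olderOf (recTerm G (histOfPrefix gk)) k) φ X :=
  rfl

/-- **THE TERMS OF THE GENERATED TOWER ARE THE GENERATED TERMS**: `E^{(j)}_{toClusterTower G}(X; g; φ) = recTerm G ↑g j X φ` for every real history
`g` — so every statement of the programme over `W1.ClusterTower` ∕ `W1.termC` ∕ `W1.functional` applies to generated towers verbatim.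
[cite: Balaban1987RG1, (0.23) p.256 and (2.13) p.268; Balaban1988RG2Cluster, (2.13) p.14] -/
theorem termC_toClusterTower (G : GenTower P 𝔸 M) (g : ℕ → ℝ) :
    ∀ (j : ℕ) (X : (domSys P M j).Dom) (φ : CPair P 𝔸), termC (toClusterTower G) j X g φ = recTerm G (fun n => ((g n : ℝ) : ℂ)) j X φ
  | 0, X, φ => by simp
  | k + 1, X, φ => by
    rw [termC_succ, toClusterTower_E, recTerm_succ]
    have h1 : ((restrictPrefix k g (Fin.last k) : ℝ) : ℂ) = ((g k : ℝ) : ℂ) := rfl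
    have h2 : olderOf (recTerm G (histOfPrefix (restrictPrefix k g))) k = olderOf (recTerm G fun n => ((g n : ℝ) : ℂ)) k :=
      funext fun j' => funext fun Y => funext fun ψ =>
        recTerm_congr_prefix G j'.1 (fun i hi => histOfPrefix_restrictPrefix g (lt_trans hi j'.2)) Y ψ
    rw [h1, h2]

/-- The (2.13) functional of the generated tower. [cite: Balaban1987RG1, (0.24) p.257 and §1 p.263 (bookkeeping)] -/
theorem functionalC_toClusterTower (G : GenTower P 𝔸 M) (g : ℕ → ℝ) (φ : CPair P 𝔸) (X : W1.Dom P M) :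
    functionalC (toClusterTower G) g φ X = recTerm G (fun n => ((g n : ℝ) : ℂ)) X.1 X.2 φ :=
  termC_toClusterTower G g X.1 X.2 φ

/-- The functional of record of the generated tower at `(g, U, ⟨j, X⟩)`: `Re recTerm G ↑g j X (ιU, 0)`. [cite: Balaban1987RG1, (0.24) p.257 (bookkeeping)] -/
theorem functional_toClusterTower [Ring 𝔸] (G : GenTower P 𝔸 M) {G' : Type} [Group G'] (ι : G' →* 𝔸ˣ) (p : RunPairing) (g : ℕ → ℝ)
    (U : GaugeField P 0 G') (X : W1.Dom P M) :
    functional (toClusterTower G) ι p g U X = (recTerm G (fun n => ((g n : ℝ) : ℂ)) X.1 X.2 (ofBackgroundC ι U)).re := by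
  rw [functional_apply, termC_toClusterTower]

end Recursion

/-! ## §3  ROAD 3 read on the object: analyticity in EVERY young coupling by induction on the recursion -/

section Analytic

variable {P : Params} {𝔸 : Type*} {M : ℕ}

/-- **SCHEMA (A-last)_k — THE NEW TERM IS ANALYTIC IN ITS LAST COUPLING** ([I] p.263 «It is a C^∞-function of g_{j−1} ∈ [0, γ], (or analytic)», read
for the one-step map with the older terms frozen in an admissible class and the configuration in the space table of the new level): for `old ∈ Adm`,
`X ∈ 𝐃_{k+1}`, `φ ∈ sp X`, `t ↦ E_k(t, old)(X; φ)` is analytic on `D ⊂ ℂ`.  Asserted nowhere. [cite: Balaban1987RG1, §1 p.263 (clause before (1.18)) and p.266] -/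
def StepGen.AnalyticInLast {k : ℕ} (G : StepGen P 𝔸 M k) (D : Set ℂ) (Adm : Set (OlderTerms P 𝔸 M k))
    (sp : (domSys P M (k + 1)).Dom → Set (CPair P 𝔸)) : Prop :=
  ∀ old ∈ Adm, ∀ (X : (domSys P M (k + 1)).Dom), ∀ φ ∈ sp X, AnalyticOnNhd ℂ (fun t => G.E t old φ X) D

/-- **SCHEMA (A-prop)_k — ANALYTIC DEPENDENCE ON A PARAMETER PASSES FROM THE OLDER TERMS TO THE NEW TERM** (the (1.41)∘(2.14) mechanism: the
potentials are built term by term from the older terms, (1.23) p.7, and enter the convergent expansion (2.13)–(2.14); NOT PRINTED as a statement — [I]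
p.266 asserts the conclusion «E^{(j)}, β_j are analytic functions of the effective coupling constants»): for every curve `s ↦ c s` of admissible
older-term families on `D` whose every level is analytic in `s` on the older space table, and every last coupling `t ∈ D`, the new term
`s ↦ E_k(t, c s)(X; φ)` is analytic on `D` for `φ ∈ sp X`.  Asserted nowhere. [cite: Balaban1988RG2Cluster, (1.23) p.7, (1.41) p.11 and (2.13)-(2.14) pp.14-15; Balaban1987RG1, p.266] -/
def StepGen.PropagatesAnalyticity {k : ℕ} (G : StepGen P 𝔸 M k) (D : Set ℂ) (Adm : Set (OlderTerms P 𝔸 M k))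
    (spOld : (j : Fin (k + 1)) → (domSys P M j).Dom → Set (CPair P 𝔸)) (sp : (domSys P M (k + 1)).Dom → Set (CPair P 𝔸)) : Prop :=
  ∀ c : ℂ → OlderTerms P 𝔸 M k, (∀ s ∈ D, c s ∈ Adm) →
    (∀ (j : Fin (k + 1)) (Y : (domSys P M j).Dom), ∀ ψ ∈ spOld j Y, AnalyticOnNhd ℂ (fun s => c s j Y ψ) D) →
      ∀ t ∈ D, ∀ (X : (domSys P M (k + 1)).Dom), ∀ φ ∈ sp X, AnalyticOnNhd ℂ (fun s => G.E t (c s) φ X) D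

/-- **ADMISSIBILITY BOOKKEEPING**: along every coupling history with values in `D`, the generated older terms of every step lie in that step's admissible
class (in print: the inductive hypotheses (1.18)–(1.19) and analyticity on `U^c_j`, [I] p.263, re-established at each step — an OUTPUT of the
construction, here a hypothesis schema).  Asserted nowhere. [cite: Balaban1987RG1, §1 p.263 (the inductive assumptions)] -/
def RecAdmissible (G : GenTower P 𝔸 M) (D : Set ℂ) (Adm : (k : ℕ) → Set (OlderTerms P 𝔸 M k)) : Prop :=
  ∀ g : ℕ → ℂ, (∀ n, g n ∈ D) → ∀ k, olderOf (recTerm G g) k ∈ Adm k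

/-- Updating one coupling of a history with values in `D` by a value of `D` keeps the values in `D`. [folklore] -/
private theorem update_mem {D : Set ℂ} {g : ℕ → ℂ} (hg : ∀ n, g n ∈ D) {i : ℕ} {s : ℂ} (hs : s ∈ D) (n : ℕ) :
    Function.update g i s n ∈ D := by
  rcases eq_or_ne n i with rfl | h
  · rw [Function.update_self]
    exact hs
  · rw [Function.update_of_ne h]
    exact hg n

/-- **ROAD 3 ON THE OBJECT — ANALYTICITY OF EVERY TERM IN EVERY YOUNG COUPLING, BY INDUCTION ON W1's RECURSION**: under (A-last)_k, (A-prop)_k at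
every step and the admissibility bookkeeping, for every coupling history `g` with values in `D`, every creation step `j`, every coupling index
`i < j`, `X ∈ 𝐃_j` and `φ ∈ sp j X`, the coordinate section `s ↦ E^{(j)}(X; g|g_i:=s; φ)` is analytic on `D`.  Proof: the levels `≤ i` do not read
`g_i` (`recTerm_congr_prefix`); level `i + 1` reads it as its last coupling ((A-last)); the higher levels read it through the older terms only
(`recTerm_succ`) and inherit analyticity by (A-prop) and the induction hypothesis. [cite: Balaban1987RG1, p.263, p.266 and (2.13) p.268; Balaban1988RG2Cluster, (1.41) p.11 and (2.14) p.15] -/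
theorem analyticInEach_recTerm (G : GenTower P 𝔸 M) {D : Set ℂ} {Adm : (k : ℕ) → Set (OlderTerms P 𝔸 M k)}
    {sp : (j : ℕ) → (domSys P M j).Dom → Set (CPair P 𝔸)} (hAdm : RecAdmissible G D Adm)
    (hlast : ∀ k, (G k).AnalyticInLast D (Adm k) (sp (k + 1)))
    (hprop : ∀ k, (G k).PropagatesAnalyticity D (Adm k) (fun j => sp j) (sp (k + 1))) :
    ∀ (j : ℕ) (g : ℕ → ℂ), (∀ n, g n ∈ D) → ∀ i < j, ∀ (X : (domSys P M j).Dom), ∀ φ ∈ sp j X,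
      AnalyticOnNhd ℂ (fun s => recTerm G (Function.update g i s) j X φ) D := by
  intro j
  induction j using Nat.strong_induction_on with
  | _ j ih =>
    intro g hg i hi X φ hφ
    cases j with
    | zero => exact absurd hi (Nat.not_lt_zero i)
    | succ k =>
      simp only [recTerm_succ]
      rcases Nat.lt_succ_iff_lt_or_eq.1 hi with hik | rfl
      · -- the coupling `g_i`, `i < k`, enters step `k + 1` through the older terms only
        have hk : ∀ s : ℂ, Function.update g i s k = g k := fun s => Function.update_of_ne (ne_of_gt hik) s g
        simp only [hk]
        refine hprop k (fun s => olderOf (recTerm G (Function.update g i s)) k) (fun s hs => hAdm _ (update_mem hg hs) k) ?_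
          (g k) (hg k) X φ hφ
        intro j' Y ψ hψ
        by_cases hij : i < j'.1
        · exact ih j'.1 j'.2 g hg i hij Y ψ hψ
        · have : (fun s => olderOf (recTerm G (Function.update g i s)) k j' Y ψ) = fun _ => recTerm G g j'.1 Y ψ :=
            funext fun s => recTerm_congr_prefix G j'.1
              (fun n hn => Function.update_of_ne (Nat.ne_of_lt (lt_of_lt_of_le hn (Nat.not_lt.1 hij))) s g) Y ψ
          rw [this]
          exact analyticOnNhd_const
      · -- the last coupling `g_k` of step `k + 1`: the older terms do not read it
        have : (fun s => (G i).E (Function.update g i s i) (olderOf (recTerm G (Function.update g i s)) i) φ X) =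
            fun s => (G i).E s (olderOf (recTerm G g) i) φ X := by
          funext s
          rw [Function.update_self]
          refine congrArg (fun old => (G i).E s old φ X) ?_
          funext j' Y ψ
          exact recTerm_congr_prefix G j'.1 (fun n hn => Function.update_of_ne (Nat.ne_of_lt (lt_of_lt_of_le hn (Nat.le_of_lt_succ j'.2))) s g) Y ψ
        rw [this]
        exact hlast i _ (hAdm g hg i) X φ hφ

/-- **THE REAL-WINDOW READING — [I] p.266 FOR THE GENERATED TOWER**: g0's `W1.AnalyticInEachOfRecord (toClusterTower G) W I sp` (typer NE-I's
`AnalyticInEachCoupling266` on W1's `functionalC`: every young-coupling section `s ↦ E^{(j)}(X; h|h_i:=s; φ)`, `i < j`, real-analytic on `I`) for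
every history set `W` and coordinate set `I` read inside `D` — from the schemas, by `analyticInEach_recTerm` and restriction of scalars along `ℝ → ℂ`.
[cite: Balaban1987RG1, p.266 (paragraph after (2.9)) with p.263] -/
theorem analyticInEachOfRecord_toClusterTower [NormedRing 𝔸] [NormedAlgebra ℂ 𝔸] (G : GenTower P 𝔸 M) {D : Set ℂ}
    {Adm : (k : ℕ) → Set (OlderTerms P 𝔸 M k)} {sp : (j : ℕ) → (domSys P M j).Dom → Set (CPair P 𝔸)} (hAdm : RecAdmissible G D Adm)
    (hlast : ∀ k, (G k).AnalyticInLast D (Adm k) (sp (k + 1)))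
    (hprop : ∀ k, (G k).PropagatesAnalyticity D (Adm k) (fun j => sp j) (sp (k + 1))) {W : Set (ℕ → ℝ)} {I : Set ℝ}
    (hW : ∀ h ∈ W, ∀ n, ((h n : ℝ) : ℂ) ∈ D) (hI : ∀ s ∈ I, ((s : ℝ) : ℂ) ∈ D) :
    AnalyticInEachOfRecord (toClusterTower G) W I sp := by
  intro X φ hφ h hh i hi
  have key : AnalyticOnNhd ℂ (fun s : ℂ => recTerm G (Function.update (fun n => ((h n : ℝ) : ℂ)) i s) X.1 X.2 φ) (Complex.ofReal '' I) :=
    (analyticInEach_recTerm G hAdm hlast hprop X.1 _ (hW h hh) i hi X.2 φ hφ).mono (by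
      rintro _ ⟨s, hs, rfl⟩
      exact hI s hs)
  have hre : (fun s : ℝ => functionalC (toClusterTower G) (Function.update h i s) φ X) =
      fun s : ℝ => (fun z : ℂ => recTerm G (Function.update (fun n => ((h n : ℝ) : ℂ)) i z) X.1 X.2 φ) (s : ℂ) := by
    funext s
    rw [functionalC_toClusterTower]
    exact congrArg (fun g' => recTerm G g' X.1 X.2 φ) (Function.comp_update (fun x : ℝ => (x : ℂ)) h i s)
  rw [hre]
  exact (key.restrictScalars.comp (Complex.ofRealCLM.analyticOnNhd _) (Set.mapsTo_image _ _)).analyticOn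

end Analytic

/-! ## §4  THE SCHEMAS ASKED ONLY BELOW A RUN LENGTH — §3's sockets for the truncated towers of record (v1.2)

The run of record on the `K`-th torus performs the steps `0, …, K − 1` and creates the terms of the levels `1, …, K` only (§1: `truncRun K`,
`runTowers`).  §3's `analyticInEach_recTerm` asks the per-step schemas (A-last)_k, (A-prop)_k and the admissibility bookkeeping at EVERY step `k` — also
at the steps `k ≥ K` whose terms the run tower discards (dag-n22-e g4, pub-ymgap bus 2026-08-27: «analyticity data about junk»).  W1's strong induction
reads, for the terms of the levels `j ≤ K`, the schemas of the steps `k < K` only: this section threads that bound (`analyticInEach_recTerm_of_lt`, the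
signature asked for on the bus), separates the LAST-coupling reading — (A-last)_k and admissibility at the ONE step `k`, no induction and no (A-prop)
(`analyticInLast_recTerm`; [I] p.263 prints the analytic alternative for the last coupling only) — and reads both on g0's ∕ g3's real-window clauses
`AnalyticInEachOfRecord` ∕ `AnalyticInLastOfRecord` for the generated tower and for the run towers `truncRun K (toClusterTower G)` =
`runTowers (fun k ↦ toClusterTower (G k)) K` (levels `≤ K` by the recursion, levels `> K` termless).  Hypothesis schemas as before; nothing asserted.
-/

section AnalyticBelow

variable {P : Params} {𝔸 : Type*} {M : ℕ}

/-- **ADMISSIBILITY BOOKKEEPING BELOW A RUN LENGTH**: §3's `RecAdmissible` asked for the steps `k < K` only — along every coupling history with values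
in `D`, the generated older terms of every step `k < K` lie in that step's admissible class.  Unfolds (`Iff.rfl`) to the displayed admissibility binder
of `analyticInEach_recTerm_of_lt`.  Asserted nowhere. [cite: Balaban1987RG1, §1 p.263 (the inductive assumptions) with (0.23)-(0.24) pp.256-257] -/
def RecAdmissibleBelow (G : GenTower P 𝔸 M) (D : Set ℂ) (Adm : (k : ℕ) → Set (OlderTerms P 𝔸 M k)) (K : ℕ) : Prop :=
  ∀ g : ℕ → ℂ, (∀ n, g n ∈ D) → ∀ k < K, olderOf (recTerm G g) k ∈ Adm k

/-- Face: the bookkeeping below `K`, displayed. [cite: Balaban1987RG1, §1 p.263 (bookkeeping)] -/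
theorem recAdmissibleBelow_iff (G : GenTower P 𝔸 M) (D : Set ℂ) (Adm : (k : ℕ) → Set (OlderTerms P 𝔸 M k)) (K : ℕ) :
    RecAdmissibleBelow G D Adm K ↔ ∀ g : ℕ → ℂ, (∀ n, g n ∈ D) → ∀ k < K, olderOf (recTerm G g) k ∈ Adm k :=
  Iff.rfl

/-- The all-steps bookkeeping gives the bookkeeping below every run length. [cite: Balaban1987RG1, §1 p.263 (bookkeeping)] -/
theorem RecAdmissible.below {G : GenTower P 𝔸 M} {D : Set ℂ} {Adm : (k : ℕ) → Set (OlderTerms P 𝔸 M k)} (h : RecAdmissible G D Adm) (K : ℕ) :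
    RecAdmissibleBelow G D Adm K :=
  fun g hg k _ => h g hg k

/-- The bookkeeping below a run length is monotone in the run length. [cite: Balaban1987RG1, §1 p.263 (bookkeeping)] -/
theorem RecAdmissibleBelow.mono {G : GenTower P 𝔸 M} {D : Set ℂ} {Adm : (k : ℕ) → Set (OlderTerms P 𝔸 M k)} {K K' : ℕ}
    (h : RecAdmissibleBelow G D Adm K') (hK : K ≤ K') : RecAdmissibleBelow G D Adm K :=
  fun g hg k hk => h g hg k (lt_of_lt_of_le hk hK)

/-- Below the run length `0` there is nothing to book. [cite: Balaban1987RG1, (0.23) p.256 (bookkeeping)] -/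
theorem recAdmissibleBelow_zero (G : GenTower P 𝔸 M) (D : Set ℂ) (Adm : (k : ℕ) → Set (OlderTerms P 𝔸 M k)) : RecAdmissibleBelow G D Adm 0 :=
  fun _ _ k hk => absurd hk (Nat.not_lt_zero k)

/-- The all-steps bookkeeping is the bookkeeping below every run length. [cite: Balaban1987RG1, §1 p.263 (bookkeeping)] -/
theorem recAdmissible_iff_forall_below (G : GenTower P 𝔸 M) (D : Set ℂ) (Adm : (k : ℕ) → Set (OlderTerms P 𝔸 M k)) :
    RecAdmissible G D Adm ↔ ∀ K, RecAdmissibleBelow G D Adm K :=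
  ⟨fun h K => h.below K, fun h g hg k => h (k + 1) g hg k (Nat.lt_succ_self k)⟩

/-- **THE LAST-COUPLING READING OF ONE STEP — NO INDUCTION**: under (A-last)_k and the admissibility of the older terms generated at step `k` (along
histories with values in `D`), the term created at step `k + 1` is analytic on `D` in its LAST coupling `g_k`, for `X ∈ 𝐃_{k+1}` and `φ ∈ sp X`: the older
terms do not read `g_k` (`recTerm_congr_prefix`), so the section `s ↦ E^{(k+1)}(X; g|g_k:=s; φ)` IS the one-step map at the frozen older terms
(`recTerm_succ`).  This is exactly the printed clause [I] p.263 «It is a C^∞-function of g_{j−1} ∈ [0, γ], (or analytic)» read on W1's recursion; the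
(A-prop) schema is not used. [cite: Balaban1987RG1, §1 p.263 (clause before (1.18)) and (2.12)-(2.13) p.268; Balaban1988RG2Cluster, (2.13)-(2.14) pp.14-15] -/
theorem analyticInLast_recTerm (G : GenTower P 𝔸 M) (k : ℕ) {D : Set ℂ} {Adm₁ : Set (OlderTerms P 𝔸 M k)}
    {sp₁ : (domSys P M (k + 1)).Dom → Set (CPair P 𝔸)} (hAdm : ∀ g : ℕ → ℂ, (∀ n, g n ∈ D) → olderOf (recTerm G g) k ∈ Adm₁)
    (hlast : (G k).AnalyticInLast D Adm₁ sp₁) :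
    ∀ (g : ℕ → ℂ), (∀ n, g n ∈ D) → ∀ (X : (domSys P M (k + 1)).Dom), ∀ φ ∈ sp₁ X,
      AnalyticOnNhd ℂ (fun s => recTerm G (Function.update g k s) (k + 1) X φ) D := by
  intro g hg X φ hφ
  have : (fun s => recTerm G (Function.update g k s) (k + 1) X φ) = fun s => (G k).E s (olderOf (recTerm G g) k) φ X := by
    funext s
    rw [recTerm_succ, Function.update_self]
    refine congrArg (fun old => (G k).E s old φ X) ?_
    funext j' Y ψ
    exact recTerm_congr_prefix G j'.1 (fun n hn => Function.update_of_ne (Nat.ne_of_lt (lt_of_lt_of_le hn (Nat.le_of_lt_succ j'.2))) s g) Y ψ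
  rw [this]
  exact hlast _ (hAdm g hg) X φ hφ

/-- **ROAD 3 ON THE OBJECT, THE SCHEMAS ASKED ONLY BELOW A RUN LENGTH** (dag-n22-e's socket): under (A-last)_k, (A-prop)_k and the admissibility
bookkeeping at the steps `k < K` ONLY, for every coupling history `g` with values in `D`, every creation step `j ≤ K`, every coupling index `i < j`,
`X ∈ 𝐃_j` and `φ ∈ sp j X`, the coordinate section `s ↦ E^{(j)}(X; g|g_i:=s; φ)` is analytic on `D` — §3's strong induction verbatim with the bound
threaded: the term of level `k + 1 ≤ K` reads (A-last)_k (coupling `i = k`, by `analyticInLast_recTerm`) or (A-prop)_k with the induction hypothesis at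
the levels `≤ k` (coupling `i < k`); the steps `≥ K` are never read.  `analyticInEach_recTerm` is the case `K = j`; the admissibility binder is
`RecAdmissibleBelow G D Adm K` unfolded. [cite: Balaban1987RG1, p.263, p.266 and (2.13) p.268 with (0.23)-(0.24) pp.256-257; Balaban1988RG2Cluster, (1.41) p.11 and (2.14) p.15] -/
theorem analyticInEach_recTerm_of_lt (G : GenTower P 𝔸 M) {D : Set ℂ} {Adm : (k : ℕ) → Set (OlderTerms P 𝔸 M k)}
    {sp : (j : ℕ) → (domSys P M j).Dom → Set (CPair P 𝔸)} (K : ℕ)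
    (hAdm : ∀ g : ℕ → ℂ, (∀ n, g n ∈ D) → ∀ k < K, olderOf (recTerm G g) k ∈ Adm k)
    (hlast : ∀ k < K, (G k).AnalyticInLast D (Adm k) (sp (k + 1)))
    (hprop : ∀ k < K, (G k).PropagatesAnalyticity D (Adm k) (fun j => sp j) (sp (k + 1))) :
    ∀ j ≤ K, ∀ (g : ℕ → ℂ), (∀ n, g n ∈ D) → ∀ i < j, ∀ (X : (domSys P M j).Dom), ∀ φ ∈ sp j X,
      AnalyticOnNhd ℂ (fun s => recTerm G (Function.update g i s) j X φ) D := by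
  intro j
  induction j using Nat.strong_induction_on with
  | _ j ih =>
    intro hjK g hg i hi X φ hφ
    cases j with
    | zero => exact absurd hi (Nat.not_lt_zero i)
    | succ k =>
      have hkK : k < K := Nat.lt_of_succ_le hjK
      rcases Nat.lt_succ_iff_lt_or_eq.1 hi with hik | rfl
      · -- the coupling `g_i`, `i < k`, enters step `k + 1` through the older terms only
        simp only [recTerm_succ]
        have hk : ∀ s : ℂ, Function.update g i s k = g k := fun s => Function.update_of_ne (ne_of_gt hik) s g
        simp only [hk]
        refine hprop k hkK (fun s => olderOf (recTerm G (Function.update g i s)) k) (fun s hs => hAdm _ (update_mem hg hs) k hkK) ?_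
          (g k) (hg k) X φ hφ
        intro j' Y ψ hψ
        by_cases hij : i < j'.1
        · exact ih j'.1 j'.2 ((Nat.le_of_lt_succ j'.2).trans hkK.le) g hg i hij Y ψ hψ
        · have : (fun s => olderOf (recTerm G (Function.update g i s)) k j' Y ψ) = fun _ => recTerm G g j'.1 Y ψ :=
            funext fun s => recTerm_congr_prefix G j'.1
              (fun n hn => Function.update_of_ne (Nat.ne_of_lt (lt_of_lt_of_le hn (Nat.not_lt.1 hij))) s g) Y ψ
          rw [this]
          exact analyticOnNhd_const
      · -- the last coupling `g_k` of step `k + 1`: one step's (A-last), no induction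
        exact analyticInLast_recTerm G i (fun g' hg' => hAdm g' hg' i hkK) (hlast i hkK) g hg X φ hφ

/-- The all-steps form of §3 from the sharp one (the case `K = j`) — a consistency face; §3's own proof is kept. [cite: Balaban1987RG1, p.266 (bookkeeping)] -/
theorem analyticInEach_recTerm_of_below (G : GenTower P 𝔸 M) {D : Set ℂ} {Adm : (k : ℕ) → Set (OlderTerms P 𝔸 M k)}
    {sp : (j : ℕ) → (domSys P M j).Dom → Set (CPair P 𝔸)} (hAdm : ∀ K, RecAdmissibleBelow G D Adm K)
    (hlast : ∀ k, (G k).AnalyticInLast D (Adm k) (sp (k + 1)))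
    (hprop : ∀ k, (G k).PropagatesAnalyticity D (Adm k) (fun j => sp j) (sp (k + 1))) (j : ℕ) :
    ∀ (g : ℕ → ℂ), (∀ n, g n ∈ D) → ∀ i < j, ∀ (X : (domSys P M j).Dom), ∀ φ ∈ sp j X,
      AnalyticOnNhd ℂ (fun s => recTerm G (Function.update g i s) j X φ) D :=
  analyticInEach_recTerm_of_lt G j (hAdm j) (fun k _ => hlast k) (fun k _ => hprop k) j le_rfl

/-- **THE TERMS OF A RUN TOWER OF GENERATED TERMS, UP TO THE RUN LENGTH, ARE THE GENERATED TERMS** (`termC_truncRun_of_le` ∘ `termC_toClusterTower`).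
[cite: Balaban1987RG1, (0.23)-(0.24) pp.256-257 and (2.13) p.268 (bookkeeping)] -/
theorem termC_truncRun_toClusterTower_of_le {K j : ℕ} (G : GenTower P 𝔸 M) (h : j ≤ K) (X : (domSys P M j).Dom) (g : ℕ → ℝ) (φ : CPair P 𝔸) :
    termC (truncRun K (toClusterTower G)) j X g φ = recTerm G (fun n => ((g n : ℝ) : ℂ)) j X φ := by
  rw [termC_truncRun_of_le _ h, termC_toClusterTower]

/-- The (2.13) functional of a run tower of generated terms up to the run length. [cite: Balaban1987RG1, (0.24) p.257 (bookkeeping)] -/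
theorem functionalC_truncRun_toClusterTower_of_le {K : ℕ} (G : GenTower P 𝔸 M) (g : ℕ → ℝ) (φ : CPair P 𝔸) (X : W1.Dom P M) (h : X.1 ≤ K) :
    functionalC (truncRun K (toClusterTower G)) g φ X = recTerm G (fun n => ((g n : ℝ) : ℂ)) X.1 X.2 φ := by
  rw [functionalC_truncRun_of_le _ g φ X h, functionalC_toClusterTower]

/-- On g0's ∕ g3's clauses: [I] p.266's coordinatewise analyticity in EVERY young coupling contains p.263's analyticity in the LAST one.
[cite: Balaban1987RG1, p.266 (paragraph after (2.9)) with p.263 (clause before (1.18))] -/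
theorem analyticInLastOfRecord_of_analyticInEachOfRecord [NormedRing 𝔸] [NormedAlgebra ℂ 𝔸] [CompleteSpace 𝔸] {S : ClusterTower P 𝔸 M}
    {W : Set (ℕ → ℝ)} {I : Set ℝ} {sp : (j : ℕ) → (domSys P M j).Dom → Set (CPair P 𝔸)} (h : AnalyticInEachOfRecord S W I sp) :
    AnalyticInLastOfRecord S W I sp :=
  fun X φ hφ g hg i hi => h X φ hφ g hg i (by omega)

/-- **[I] p.263 «(or analytic)» FOR THE GENERATED TOWER, FROM (A-last) AT EVERY STEP AND THE BOOKKEEPING ALONE**: g3's `W1.AnalyticInLastOfRecord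
(toClusterTower G) W I sp` for every history set `W` and coordinate set `I` read inside `D` — by `analyticInLast_recTerm` and restriction of scalars along
`ℝ → ℂ`; no (A-prop). [cite: Balaban1987RG1, §1 p.263 (clause before (1.18)) with (2.13) p.268] -/
theorem analyticInLastOfRecord_toClusterTower [NormedRing 𝔸] [NormedAlgebra ℂ 𝔸] [CompleteSpace 𝔸] (G : GenTower P 𝔸 M) {D : Set ℂ}
    {Adm : (k : ℕ) → Set (OlderTerms P 𝔸 M k)} {sp : (j : ℕ) → (domSys P M j).Dom → Set (CPair P 𝔸)} (hAdm : RecAdmissible G D Adm)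
    (hlast : ∀ k, (G k).AnalyticInLast D (Adm k) (sp (k + 1))) {W : Set (ℕ → ℝ)} {I : Set ℝ} (hW : ∀ h ∈ W, ∀ n, ((h n : ℝ) : ℂ) ∈ D)
    (hI : ∀ s ∈ I, ((s : ℝ) : ℂ) ∈ D) :
    AnalyticInLastOfRecord (toClusterTower G) W I sp := by
  rintro ⟨j, Y⟩ φ hφ h hh i hi
  change i + 1 = j at hi
  subst hi
  have key : AnalyticOnNhd ℂ (fun s : ℂ => recTerm G (Function.update (fun n => ((h n : ℝ) : ℂ)) i s) (i + 1) Y φ) (Complex.ofReal '' I) :=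
    (analyticInLast_recTerm G i (fun g hg => hAdm g hg i) (hlast i) _ (hW h hh) Y φ hφ).mono (by
      rintro _ ⟨s, hs, rfl⟩
      exact hI s hs)
  have hre : (fun s : ℝ => functionalC (toClusterTower G) (Function.update h i s) φ ⟨i + 1, Y⟩) =
      fun s : ℝ => (fun z : ℂ => recTerm G (Function.update (fun n => ((h n : ℝ) : ℂ)) i z) (i + 1) Y φ) (s : ℂ) := by
    funext s
    rw [functionalC_toClusterTower]
    exact congrArg (fun g' => recTerm G g' (i + 1) Y φ) (Function.comp_update (fun x : ℝ => (x : ℂ)) h i s)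
  rw [hre]
  exact (key.restrictScalars.comp (Complex.ofRealCLM.analyticOnNhd _) (Set.mapsTo_image _ _)).analyticOn

/-- **[I] p.266 FOR THE RUN TOWER OF GENERATED TERMS, FROM THE SCHEMAS BELOW THE RUN LENGTH**: g0's `W1.AnalyticInEachOfRecord
(truncRun K (toClusterTower G)) W I sp` for `W`, `I` read inside `D` — the levels `j ≤ K` by `analyticInEach_recTerm_of_lt` and restriction of scalars,
the levels `j > K` termless (`functionalC_truncRun_eq_zero`: the zero section is analytic). [cite: Balaban1987RG1, p.266 (paragraph after (2.9)) with p.263 and (0.23)-(0.24) pp.256-257] -/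
theorem analyticInEachOfRecord_truncRun_toClusterTower_of_lt [NormedRing 𝔸] [NormedAlgebra ℂ 𝔸] (G : GenTower P 𝔸 M) {D : Set ℂ}
    {Adm : (k : ℕ) → Set (OlderTerms P 𝔸 M k)} {sp : (j : ℕ) → (domSys P M j).Dom → Set (CPair P 𝔸)} (K : ℕ)
    (hAdm : ∀ g : ℕ → ℂ, (∀ n, g n ∈ D) → ∀ k < K, olderOf (recTerm G g) k ∈ Adm k)
    (hlast : ∀ k < K, (G k).AnalyticInLast D (Adm k) (sp (k + 1)))
    (hprop : ∀ k < K, (G k).PropagatesAnalyticity D (Adm k) (fun j => sp j) (sp (k + 1))) {W : Set (ℕ → ℝ)} {I : Set ℝ}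
    (hW : ∀ h ∈ W, ∀ n, ((h n : ℝ) : ℂ) ∈ D) (hI : ∀ s ∈ I, ((s : ℝ) : ℂ) ∈ D) :
    AnalyticInEachOfRecord (truncRun K (toClusterTower G)) W I sp := by
  intro X φ hφ h hh i hi
  rcases Nat.lt_or_ge K X.1 with hX | hX
  · have : (fun s : ℝ => functionalC (truncRun K (toClusterTower G)) (Function.update h i s) φ X) = fun _ => 0 :=
      funext fun s => functionalC_truncRun_eq_zero _ _ φ X hX
    rw [this]
    exact analyticOnNhd_const.analyticOn
  · have key : AnalyticOnNhd ℂ (fun s : ℂ => recTerm G (Function.update (fun n => ((h n : ℝ) : ℂ)) i s) X.1 X.2 φ) (Complex.ofReal '' I) :=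
      (analyticInEach_recTerm_of_lt G K hAdm hlast hprop X.1 hX _ (hW h hh) i hi X.2 φ hφ).mono (by
        rintro _ ⟨s, hs, rfl⟩
        exact hI s hs)
    have hre : (fun s : ℝ => functionalC (truncRun K (toClusterTower G)) (Function.update h i s) φ X) =
        fun s : ℝ => (fun z : ℂ => recTerm G (Function.update (fun n => ((h n : ℝ) : ℂ)) i z) X.1 X.2 φ) (s : ℂ) := by
      funext s
      rw [functionalC_truncRun_toClusterTower_of_le G _ φ X hX]
      exact congrArg (fun g' => recTerm G g' X.1 X.2 φ) (Function.comp_update (fun x : ℝ => (x : ℂ)) h i s)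
    rw [hre]
    exact (key.restrictScalars.comp (Complex.ofRealCLM.analyticOnNhd _) (Set.mapsTo_image _ _)).analyticOn

/-- **[I] p.263 «(or analytic)» FOR THE RUN TOWER OF GENERATED TERMS, FROM (A-last) AND THE BOOKKEEPING BELOW THE RUN LENGTH** — no (A-prop): g3's
`W1.AnalyticInLastOfRecord (truncRun K (toClusterTower G)) W I sp` (levels `≤ K` by `analyticInLast_recTerm`, levels `> K` termless).
[cite: Balaban1987RG1, §1 p.263 (clause before (1.18)) with (0.23)-(0.24) pp.256-257] -/
theorem analyticInLastOfRecord_truncRun_toClusterTower_of_lt [NormedRing 𝔸] [NormedAlgebra ℂ 𝔸] [CompleteSpace 𝔸] (G : GenTower P 𝔸 M)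
    {D : Set ℂ} {Adm : (k : ℕ) → Set (OlderTerms P 𝔸 M k)} {sp : (j : ℕ) → (domSys P M j).Dom → Set (CPair P 𝔸)} (K : ℕ)
    (hAdm : ∀ g : ℕ → ℂ, (∀ n, g n ∈ D) → ∀ k < K, olderOf (recTerm G g) k ∈ Adm k)
    (hlast : ∀ k < K, (G k).AnalyticInLast D (Adm k) (sp (k + 1))) {W : Set (ℕ → ℝ)} {I : Set ℝ} (hW : ∀ h ∈ W, ∀ n, ((h n : ℝ) : ℂ) ∈ D)
    (hI : ∀ s ∈ I, ((s : ℝ) : ℂ) ∈ D) :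
    AnalyticInLastOfRecord (truncRun K (toClusterTower G)) W I sp := by
  rintro ⟨j, Y⟩ φ hφ h hh i hi
  change i + 1 = j at hi
  subst hi
  rcases Nat.lt_or_ge K (i + 1) with hX | hX
  · have : (fun s : ℝ => functionalC (truncRun K (toClusterTower G)) (Function.update h i s) φ ⟨i + 1, Y⟩) = fun _ => 0 :=
      funext fun s => functionalC_truncRun_eq_zero _ _ φ ⟨i + 1, Y⟩ hX
    rw [this]
    exact analyticOnNhd_const.analyticOn
  · have hiK : i < K := Nat.lt_of_succ_le hX
    have key : AnalyticOnNhd ℂ (fun s : ℂ => recTerm G (Function.update (fun n => ((h n : ℝ) : ℂ)) i s) (i + 1) Y φ) (Complex.ofReal '' I) :=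
      (analyticInLast_recTerm G i (fun g hg => hAdm g hg i hiK) (hlast i hiK) _ (hW h hh) Y φ hφ).mono (by
        rintro _ ⟨s, hs, rfl⟩
        exact hI s hs)
    have hre : (fun s : ℝ => functionalC (truncRun K (toClusterTower G)) (Function.update h i s) φ ⟨i + 1, Y⟩) =
        fun s : ℝ => (fun z : ℂ => recTerm G (Function.update (fun n => ((h n : ℝ) : ℂ)) i z) (i + 1) Y φ) (s : ℂ) := by
      funext s
      rw [functionalC_truncRun_toClusterTower_of_le G _ φ ⟨i + 1, Y⟩ hX]
      exact congrArg (fun g' => recTerm G g' (i + 1) Y φ) (Function.comp_update (fun x : ℝ => (x : ℂ)) h i s)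
    rw [hre]
    exact (key.restrictScalars.comp (Complex.ofRealCLM.analyticOnNhd _) (Set.mapsTo_image _ _)).analyticOn

variable {F : T4Family}

/-- **PER TORUS — [I] p.266 FOR THE RUN TOWER OF RECORD OF GENERATED TERMS** `runTowers (fun k ↦ toClusterTower (G k)) k` (the run of `k` steps on the
`k`-th torus): from the schemas and the bookkeeping at the steps `m < k` of the `k`-th generator only. [cite: Balaban1987RG1, p.266 with (0.23)-(0.24) pp.256-257] -/
theorem analyticInEachOfRecord_runTowers_toClusterTower [NormedRing 𝔸] [NormedAlgebra ℂ 𝔸] (G : (k : ℕ) → GenTower (F.P k) 𝔸 M) (k : ℕ)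
    {D : Set ℂ} {Adm : (m : ℕ) → Set (OlderTerms (F.P k) 𝔸 M m)} {sp : (j : ℕ) → (domSys (F.P k) M j).Dom → Set (CPair (F.P k) 𝔸)}
    (hAdm : ∀ g : ℕ → ℂ, (∀ n, g n ∈ D) → ∀ m < k, olderOf (recTerm (G k) g) m ∈ Adm m)
    (hlast : ∀ m < k, (G k m).AnalyticInLast D (Adm m) (sp (m + 1)))
    (hprop : ∀ m < k, (G k m).PropagatesAnalyticity D (Adm m) (fun j => sp j) (sp (m + 1))) {W : Set (ℕ → ℝ)} {I : Set ℝ}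
    (hW : ∀ h ∈ W, ∀ n, ((h n : ℝ) : ℂ) ∈ D) (hI : ∀ s ∈ I, ((s : ℝ) : ℂ) ∈ D) :
    AnalyticInEachOfRecord (runTowers (fun k => toClusterTower (G k)) k) W I sp :=
  analyticInEachOfRecord_truncRun_toClusterTower_of_lt (G k) k hAdm hlast hprop hW hI

/-- **PER TORUS — [I] p.263 «(or analytic)» FOR THE RUN TOWER OF RECORD OF GENERATED TERMS**, from (A-last) and the bookkeeping at the steps `m < k`
of the `k`-th generator only. [cite: Balaban1987RG1, §1 p.263 with (0.23)-(0.24) pp.256-257] -/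
theorem analyticInLastOfRecord_runTowers_toClusterTower [NormedRing 𝔸] [NormedAlgebra ℂ 𝔸] [CompleteSpace 𝔸]
    (G : (k : ℕ) → GenTower (F.P k) 𝔸 M) (k : ℕ) {D : Set ℂ} {Adm : (m : ℕ) → Set (OlderTerms (F.P k) 𝔸 M m)}
    {sp : (j : ℕ) → (domSys (F.P k) M j).Dom → Set (CPair (F.P k) 𝔸)}
    (hAdm : ∀ g : ℕ → ℂ, (∀ n, g n ∈ D) → ∀ m < k, olderOf (recTerm (G k) g) m ∈ Adm m)
    (hlast : ∀ m < k, (G k m).AnalyticInLast D (Adm m) (sp (m + 1))) {W : Set (ℕ → ℝ)} {I : Set ℝ}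
    (hW : ∀ h ∈ W, ∀ n, ((h n : ℝ) : ℂ) ∈ D) (hI : ∀ s ∈ I, ((s : ℝ) : ℂ) ∈ D) :
    AnalyticInLastOfRecord (runTowers (fun k => toClusterTower (G k)) k) W I sp :=
  analyticInLastOfRecord_truncRun_toClusterTower_of_lt (G k) k hAdm hlast hW hI

end AnalyticBelow

end W1

end Literature.MathematicalPhysics.QuantumFieldTheory.Balaban1983to89.Node00
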